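import Mathlib
import HarnessLib
import Summits.Langlands.Langlands.Theorems.NonParallelVoidTensorSquareParallelStubResidualIrreducibilityTensorLine

/-!
# Stub `stub_residualIrreducibility` of crux `TensorSquareParallel` (stmt-Langlands-17009), helper 2b:
# irreducibility of the tensor product of two `2`-dimensional representations — the criterion

Sequel of `…StubResidualIrreducibilityTensorLine` (generalities, stable lines, isotropic planes).
Let `Λ` be a group, `k` an algebraically closed field with `2 ≠ 0`, and `V, V' : Λ → GL₂(k)`
two representations without common eigenvector (irreducible) such that

* (non-dihedral) no character `η ≠ 1` of `Λ` satisfies `tr V = η · tr V` pointwise, and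
* (not a twist) `V'` is not conjugate to a twist `χ ⊗ V` of `V` by a character `χ : Λ → kˣ`.

Then the tensor product `V ⊗ V'`, realised on `M₂(k)` by `X ↦ V(λ) X V'(λ)ᵀ`, is irreducible:
the only stable subspaces are `0` and `M₂(k)` (`stub_residualIrreducibility_tensor`), WITHOUT
Dickson's classification: a stable line is excluded in the prequel; a stable hyperplane has a
stable orthogonal line for the determinant pairing `B` (pairs act by similitudes); a stable
plane `W` has `W ∩ W^⊥` a stable line, or `W` totally isotropic (prequel), or `0`: then its two
isotropic lines `k v₁w₁ᵀ`, `k v₂w₂ᵀ` are permuted by `Λ`, the stabiliser `Λ₀` has index `2`,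
`V(Λ₀)` is diagonal and `V(Λ ∖ Λ₀)` anti-diagonal in the basis `(v₁, v₂)`, so `tr V = η · tr V`
for the sign character `η ≠ 1` of `Λ/Λ₀` — excluded (`not_stable_nondegenerate_plane`).

## References

* [Calegari2010] F. Calegari, *Even Galois representations and the Fontaine–Mazur conjecture*,
  Invent. Math. 185 (2011) 1–16, §2 and §6 (the tensor induction and its residual image).
* J.-P. Serre, *Linear representations of finite groups*, §7.2–§8.1 (Clifford theory for index
  two), for the dihedral mechanism.
-/

set_option linter.dupNamespace false

noncomputable section

namespace Summit.Langlands.Langlands.Theorems.TensorSquareParallel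

open scoped MatrixGroups
open Matrix Module

variable {k : Type*} [Field k] {Λ : Type*} [Group Λ]

section Plane

variable (V V' : Λ →* GL (Fin 2) k)

omit [Group Λ] in
/-- **An isotropic basis of a non-degenerate plane**: over an algebraically closed field with
`2 ≠ 0`, a plane `W` on which a symmetric bilinear form `B` is non-degenerate
(`W ∩ W^⊥ = 0`) has elements `X₁, X₂` with `B(X₁,X₁) = B(X₂,X₂) = 0 ≠ B(X₁,X₂)` (diagonalise
the binary quadratic form `B|_W`). [folklore] -/
theorem exists_isotropic_pair {M : Type*} [AddCommGroup M] [Module k M] [FiniteDimensional k M]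
    [IsAlgClosed k] (h2 : (2 : k) ≠ 0) (B : LinearMap.BilinForm k M) (hsymm : ∀ X Y, B X Y = B Y X)
    {W : Submodule k M} (hW2 : finrank k W = 2) (hnd : W ⊓ B.orthogonal W = ⊥) :
    ∃ X₁ X₂ : M, X₁ ∈ W ∧ X₂ ∈ W ∧ B X₁ X₁ = 0 ∧ B X₂ X₂ = 0 ∧ B X₁ X₂ ≠ 0 := by
  -- (i) an isotropic non-zero vector
  obtain ⟨X₁, hX₁W, hX₁0, h11⟩ : ∃ X₁ ∈ W, X₁ ≠ 0 ∧ B X₁ X₁ = 0 := by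
    obtain ⟨Y₁, Y₂, hY₁, hY₂, hli⟩ := exists_linearIndependent_pair_of_finrank_eq_two hW2
    by_cases hb : B Y₁ Y₁ = 0
    · exact ⟨Y₁, hY₁, by simpa using hli.ne_zero 0, hb⟩
    · -- a root of `B(Y₁,Y₁) a² + 2 B(Y₁,Y₂) a + B(Y₂,Y₂)`
      obtain ⟨a, ha⟩ := IsAlgClosed.exists_root
        (Polynomial.C (B Y₁ Y₁) * Polynomial.X ^ 2 + Polynomial.C (2 * B Y₁ Y₂) * Polynomial.X +
          Polynomial.C (B Y₂ Y₂)) (by rw [Polynomial.degree_quadratic hb]; decide)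
      simp only [Polynomial.IsRoot.def, Polynomial.eval_add, Polynomial.eval_mul,
        Polynomial.eval_C, Polynomial.eval_pow, Polynomial.eval_X] at ha
      refine ⟨a • Y₁ + Y₂, W.add_mem (W.smul_mem a hY₁) hY₂, fun h0 => ?_, ?_⟩
      · have := (LinearIndependent.pair_iff.mp hli) a 1 (by rw [one_smul, h0])
        exact one_ne_zero this.2
      · simp only [map_add, map_smul, LinearMap.add_apply, LinearMap.smul_apply, smul_eq_mul,
          hsymm Y₂ Y₁]
        linear_combination ha
  -- (ii) a partner `Y ∈ W` with `B(X₁, Y) ≠ 0`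
  obtain ⟨Y, hYW, hXY⟩ : ∃ Y ∈ W, B X₁ Y ≠ 0 := by
    by_contra hall
    push Not at hall
    apply hX₁0
    have : X₁ ∈ W ⊓ B.orthogonal W := by
      refine Submodule.mem_inf.mpr ⟨hX₁W, ?_⟩
      rw [LinearMap.BilinForm.mem_orthogonal_iff]
      intro n hn
      change B n X₁ = 0
      rw [hsymm]; exact hall n hn
    rw [hnd] at this
    exact (Submodule.mem_bot k).mp this
  -- (iii) the second isotropic vector `Y - (B(Y,Y)/(2 B(X₁,Y))) X₁`
  refine ⟨X₁, Y - (B Y Y / (2 * B X₁ Y)) • X₁, hX₁W, W.sub_mem hYW (W.smul_mem _ hX₁W), h11,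
    ?_, ?_⟩
  · simp only [map_sub, map_smul, LinearMap.sub_apply, LinearMap.smul_apply, smul_eq_mul, h11,
      hsymm Y X₁]
    field_simp
    ring
  · simp only [map_sub, map_smul, smul_eq_mul, h11, mul_zero, sub_zero]
    exact hXY

omit [Group Λ] in
/-- In a plane with isotropic basis `X₁, X₂` (`B(X₁,X₂) ≠ 0`, `2 ≠ 0`), the isotropic vectors
are exactly the two lines `k X₁`, `k X₂`. [folklore] -/
theorem mem_span_or_of_isotropic {M : Type*} [AddCommGroup M] [Module k M] [FiniteDimensional k M]
    (h2 : (2 : k) ≠ 0) (B : LinearMap.BilinForm k M) (hsymm : ∀ X Y, B X Y = B Y X)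
    {W : Submodule k M} (hW2 : finrank k W = 2) {X₁ X₂ : M} (h1 : X₁ ∈ W) (h2m : X₂ ∈ W)
    (h11 : B X₁ X₁ = 0) (h22 : B X₂ X₂ = 0) (h12 : B X₁ X₂ ≠ 0) {Z : M} (hZ : Z ∈ W)
    (hZZ : B Z Z = 0) : Z ∈ k ∙ X₁ ∨ Z ∈ k ∙ X₂ := by
  have hli := linearIndependent_of_pairing B h11 h12
  obtain ⟨a, b, rfl⟩ := exists_eq_add_of_finrank_eq_two hW2 h1 h2m hli Z hZ
  simp only [map_add, map_smul, LinearMap.add_apply, LinearMap.smul_apply, smul_eq_mul, h11, h22,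
    hsymm X₂ X₁] at hZZ
  have hab : 2 * B X₁ X₂ * (a * b) = 0 := by linear_combination hZZ
  rcases mul_eq_zero.mp hab with h | h
  · exact absurd h (mul_ne_zero h2 h12)
  rcases mul_eq_zero.mp h with ha | hb
  · right; rw [ha, zero_smul, zero_add]; exact Submodule.smul_mem _ _ (Submodule.mem_span_singleton_self _)
  · left; rw [hb, zero_smul, add_zero]; exact Submodule.smul_mem _ _ (Submodule.mem_span_singleton_self _)

omit [Group Λ] in
/-- Two independent vectors do not lie on one line. [folklore] -/
theorem not_mem_span_of_linearIndependent {M : Type*} [AddCommGroup M] [Module k M] {Z₁ Z₂ Y : M}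
    (hli : LinearIndependent k ![Z₁, Z₂]) (h1 : Z₁ ∈ k ∙ Y) (h2 : Z₂ ∈ k ∙ Y) : False := by
  obtain ⟨a, rfl⟩ := Submodule.mem_span_singleton.mp h1
  obtain ⟨b, rfl⟩ := Submodule.mem_span_singleton.mp h2
  have := (LinearIndependent.pair_iff.mp hli) b (-a)
    (by rw [smul_smul, smul_smul, mul_comm b a, neg_mul, neg_smul, add_neg_cancel])
  have ha : a = 0 := neg_eq_zero.mp this.2
  exact hli.ne_zero 0 (by simp [ha])

omit [Group Λ] in
/-- `tr A = 0` if `A` swaps two independent lines `k v₁`, `k v₂` of `k²`. [folklore] -/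
theorem trace_eq_zero_of_swap (A : Matrix (Fin 2) (Fin 2) k) {v₁ v₂ : Fin 2 → k}
    (hd : v₁ 0 * v₂ 1 - v₁ 1 * v₂ 0 ≠ 0) (h1 : A *ᵥ v₁ ∈ k ∙ v₂) (h2 : A *ᵥ v₂ ∈ k ∙ v₁) :
    A.trace = 0 := by
  obtain ⟨a, ha⟩ := Submodule.mem_span_singleton.mp h1
  obtain ⟨b, hb⟩ := Submodule.mem_span_singleton.mp h2
  have e1 := congr_fun ha 0
  have e2 := congr_fun ha 1
  have e3 := congr_fun hb 0
  have e4 := congr_fun hb 1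
  simp only [Pi.smul_apply, smul_eq_mul, Matrix.mulVec, dotProduct, Fin.sum_univ_two] at e1 e2 e3 e4
  have key : A.trace * (v₁ 0 * v₂ 1 - v₁ 1 * v₂ 0) = 0 := by
    rw [Matrix.trace_fin_two]
    linear_combination (-(v₂ 1)) * e1 + v₁ 1 * e3 + (-(v₁ 0)) * e4 + v₂ 0 * e2
  exact (mul_eq_zero.mp key).resolve_right hd

/-- **No stable non-degenerate plane.**  If a stable plane `W` has `W ∩ W^⊥ = 0`, its two
isotropic lines `k X₁ = k v₁w₁ᵀ`, `k X₂ = k v₂w₂ᵀ` (`det(v₁,v₂) ≠ 0`) are permuted by every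
`λ`; if all `λ` fix them, `k X₁` is a stable line (excluded by `not_stable_line`); otherwise the
stabiliser `Λ₀` has index two, `V(λ) v_i ∈ k v_i` for `λ ∈ Λ₀` and `V(λ)` swaps `k v₁`, `k v₂`
(so `tr V(λ) = 0`) for `λ ∉ Λ₀`, whence `tr V = η · tr V` for the sign character `η ≠ 1` of
`Λ/Λ₀` — excluded by the non-dihedral hypothesis. [folklore] -/
theorem not_stable_nondegenerate_plane [IsAlgClosed k]
    (hV : ∀ v : Fin 2 → k, v ≠ 0 → ∃ x, ((V x : GL (Fin 2) k) : Matrix (Fin 2) (Fin 2) k) *ᵥ v ∉ k ∙ v)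
    (hi : ¬ ∃ η : Λ →* kˣ, η ≠ 1 ∧ ∀ x, ((V x : GL (Fin 2) k) : Matrix (Fin 2) (Fin 2) k).trace =
      (η x : k) * ((V x : GL (Fin 2) k) : Matrix (Fin 2) (Fin 2) k).trace)
    (hii : ¬ ∃ (χ : Λ →* kˣ) (P : GL (Fin 2) k), ∀ x,
      ((V' x : GL (Fin 2) k) : Matrix (Fin 2) (Fin 2) k) =
        (χ x : k) • (((P * V x * P⁻¹ : GL (Fin 2) k)) : Matrix (Fin 2) (Fin 2) k))
    (h2 : (2 : k) ≠ 0) {B : LinearMap.BilinForm k (Matrix (Fin 2) (Fin 2) k)}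
    (hB : ∀ X Y, B X Y = X 0 0 * Y 1 1 - X 0 1 * Y 1 0 - X 1 0 * Y 0 1 + X 1 1 * Y 0 0)
    {W : Submodule k (Matrix (Fin 2) (Fin 2) k)}
    (hW : ∀ x, ∀ X ∈ W, ((V x : GL (Fin 2) k) : Matrix (Fin 2) (Fin 2) k) * X *
      ((V' x : GL (Fin 2) k) : Matrix (Fin 2) (Fin 2) k)ᵀ ∈ W)
    (hW2 : finrank k W = 2) (hnd : W ⊓ B.orthogonal W = ⊥) : False := by
  classical
  have hsymm := pairing_comm hB
  obtain ⟨X₁, X₂, h1, h2m, h11, h22, h12⟩ := exists_isotropic_pair h2 B hsymm hW2 hnd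
  have hli := linearIndependent_of_pairing B h11 h12
  have hX₁ : X₁ ≠ 0 := by simpa using hli.ne_zero 0
  have hX₂ : X₂ ≠ 0 := by simpa using hli.ne_zero 1
  -- the action
  set g : Λ → Matrix (Fin 2) (Fin 2) k → Matrix (Fin 2) (Fin 2) k := fun x X =>
    ((V x : GL (Fin 2) k) : Matrix (Fin 2) (Fin 2) k) * X *
      ((V' x : GL (Fin 2) k) : Matrix (Fin 2) (Fin 2) k)ᵀ with hg
  have hg_mul : ∀ x y X, g (x * y) X = g x (g y X) := fun x y X => by
    simp only [hg, map_mul, Units.val_mul, Matrix.transpose_mul, Matrix.mul_assoc]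
  have hg_smul : ∀ x (c : k) X, g x (c • X) = c • g x X := fun x c X => by
    simp only [hg, Matrix.mul_smul, Matrix.smul_mul]
  have hg_iso : ∀ x X, B X X = 0 → B (g x X) (g x X) = 0 := fun x X h => by
    simp only [hg]; rw [pairing_conj hB, h, mul_zero]
  have hg_ne : ∀ x X, X ≠ 0 → g x X ≠ 0 := fun x X hX => conj_ne_zero _ _ hX
  -- images of `X₁`, `X₂` lie on the two isotropic lines, on different ones
  have hg_li : ∀ x, LinearIndependent k ![g x X₁, g x X₂] := fun x => by
    refine LinearIndependent.pair_iff.mpr fun s t hst => ?_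
    have : g x (s • X₁ + t • X₂) = 0 := by
      have e : g x (s • X₁ + t • X₂) = s • g x X₁ + t • g x X₂ := by
        simp only [hg, Matrix.mul_add, Matrix.add_mul, Matrix.mul_smul, Matrix.smul_mul]
      rw [e, hst]
    by_contra hne
    refine hg_ne x _ (fun h0 => hne ?_) this
    exact (LinearIndependent.pair_iff.mp hli) s t h0
  have dichot : ∀ x, (g x X₁ ∈ k ∙ X₁ ∧ g x X₂ ∈ k ∙ X₂) ∨ (g x X₁ ∈ k ∙ X₂ ∧ g x X₂ ∈ k ∙ X₁) := by
    intro x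
    have hx1 := mem_span_or_of_isotropic h2 B hsymm hW2 h1 h2m h11 h22 h12 (hW x _ h1) (hg_iso x _ h11)
    have hx2 := mem_span_or_of_isotropic h2 B hsymm hW2 h1 h2m h11 h22 h12 (hW x _ h2m) (hg_iso x _ h22)
    rcases hx1 with a1 | a2 <;> rcases hx2 with b1 | b2
    · exact (not_mem_span_of_linearIndependent (hg_li x) a1 b1).elim
    · exact Or.inl ⟨a1, b2⟩
    · exact Or.inr ⟨a2, b1⟩
    · exact (not_mem_span_of_linearIndependent (hg_li x) a2 b2).elim
  -- the stabiliser `Λ₀ = {λ | g λ X₁ ∈ k X₁}` of the line `k X₁` and its sign character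
  have hp_not : ∀ x, g x X₁ ∉ k ∙ X₁ → g x X₁ ∈ k ∙ X₂ ∧ g x X₂ ∈ k ∙ X₁ := fun x hx =>
    (dichot x).resolve_left fun h => hx h.1
  have hp_yes : ∀ x, g x X₁ ∈ k ∙ X₁ → g x X₂ ∈ k ∙ X₂ := fun x hx => by
    rcases dichot x with h | h
    · exact h.2
    · exact (hg_ne x X₁ hX₁ (eq_zero_of_mem_span_of_mem_span hli hx h.1)).elim
  have hp_mul : ∀ x y, g (x * y) X₁ ∈ k ∙ X₁ ↔ (g x X₁ ∈ k ∙ X₁ ↔ g y X₁ ∈ k ∙ X₁) := by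
    intro x y
    by_cases hy : g y X₁ ∈ k ∙ X₁
    · obtain ⟨c, hc⟩ := Submodule.mem_span_singleton.mp hy
      have hc0 : c ≠ 0 := by rintro rfl; exact hg_ne y X₁ hX₁ (by rw [← hc, zero_smul])
      have e : g (x * y) X₁ ∈ k ∙ X₁ ↔ g x X₁ ∈ k ∙ X₁ := by
        rw [hg_mul, ← hc, hg_smul, Submodule.smul_mem_iff _ hc0]
      rw [e]
      constructor
      · intro hx; exact iff_of_true hx hy
      · intro h; exact h.mpr hy
    · obtain ⟨c, hc⟩ := Submodule.mem_span_singleton.mp (hp_not y hy).1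
      have hc0 : c ≠ 0 := by rintro rfl; exact hg_ne y X₁ hX₁ (by rw [← hc, zero_smul])
      have e : g (x * y) X₁ ∈ k ∙ X₁ ↔ g x X₂ ∈ k ∙ X₁ := by
        rw [hg_mul, ← hc, hg_smul, Submodule.smul_mem_iff _ hc0]
      rw [e]
      constructor
      · intro hxy
        refine iff_of_false (fun hx => ?_) hy
        exact hg_ne x X₂ hX₂ (eq_zero_of_mem_span_of_mem_span hli hxy (hp_yes x hx))
      · intro h
        have hx : g x X₁ ∉ k ∙ X₁ := fun hx => hy (h.mp hx)
        exact (hp_not x hx).2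
  by_cases hall : ∀ x, g x X₁ ∈ k ∙ X₁
  · -- `k X₁` is a stable line
    refine not_stable_line V V' hV hii hX₁ fun x => ?_
    obtain ⟨c, hc⟩ := Submodule.mem_span_singleton.mp (hall x)
    exact ⟨c, hc.symm⟩
  obtain ⟨s, hs⟩ := not_forall.mp hall
  -- rank-one decompositions of the isotropic basis
  have hdet1 : X₁.det = 0 := by
    have := pairing_self hB X₁; rw [h11] at this
    exact (mul_eq_zero.mp this.symm).resolve_left h2
  have hdet2 : X₂.det = 0 := by
    have := pairing_self hB X₂; rw [h22] at this
    exact (mul_eq_zero.mp this.symm).resolve_left h2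
  obtain ⟨v₁, w₁, hv₁, hw₁, rfl⟩ := exists_eq_vecMulVec_of_det_eq_zero hX₁ hdet1
  obtain ⟨v₂, w₂, hv₂, hw₂, rfl⟩ := exists_eq_vecMulVec_of_det_eq_zero hX₂ hdet2
  rw [pairing_vecMulVec hB] at h12
  have hdv : v₁ 0 * v₂ 1 - v₁ 1 * v₂ 0 ≠ 0 := left_ne_zero_of_mul h12
  -- traces vanish off the stabiliser
  have htr : ∀ x, g x (vecMulVec v₁ w₁) ∉ k ∙ vecMulVec v₁ w₁ →
      ((V x : GL (Fin 2) k) : Matrix (Fin 2) (Fin 2) k).trace = 0 := by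
    intro x hx
    obtain ⟨hx1, hx2⟩ := hp_not x hx
    simp only [hg, mul_vecMulVec_mul_transpose] at hx1 hx2
    refine trace_eq_zero_of_swap _ hdv ?_ ?_
    · exact (mem_span_of_vecMulVec_mem_span hx1 (mulVec_ne_zero _ hv₁) (mulVec_ne_zero _ hw₁)).1
    · exact (mem_span_of_vecMulVec_mem_span hx2 (mulVec_ne_zero _ hv₂) (mulVec_ne_zero _ hw₂)).1
  -- the sign character
  have hneg : ((-1 : kˣ) : k) ≠ 1 := by
    intro h
    apply h2
    have e : (2 : k) = 1 - ((-1 : kˣ) : k) := by push_cast; ring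
    rw [e, h, sub_self]
  have hone : g 1 (vecMulVec v₁ w₁) ∈ k ∙ vecMulVec v₁ w₁ := by
    simp only [hg, map_one, Units.val_one, Matrix.one_mul, Matrix.transpose_one, Matrix.mul_one]
    exact Submodule.mem_span_singleton_self _
  let η : Λ →* kˣ :=
    { toFun := fun x => if g x (vecMulVec v₁ w₁) ∈ k ∙ vecMulVec v₁ w₁ then 1 else -1,
      map_one' := by
        change (if g 1 (vecMulVec v₁ w₁) ∈ k ∙ vecMulVec v₁ w₁ then (1 : kˣ) else -1) = 1
        rw [if_pos hone],
      map_mul' := fun x y => by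
        change (if g (x * y) (vecMulVec v₁ w₁) ∈ k ∙ vecMulVec v₁ w₁ then (1 : kˣ) else -1) =
          (if g x (vecMulVec v₁ w₁) ∈ k ∙ vecMulVec v₁ w₁ then (1 : kˣ) else -1) *
          (if g y (vecMulVec v₁ w₁) ∈ k ∙ vecMulVec v₁ w₁ then (1 : kˣ) else -1)
        have hxy := hp_mul x y
        by_cases hx : g x (vecMulVec v₁ w₁) ∈ k ∙ vecMulVec v₁ w₁ <;>
          by_cases hy : g y (vecMulVec v₁ w₁) ∈ k ∙ vecMulVec v₁ w₁
        · rw [if_pos (hxy.mpr (iff_of_true hx hy)), if_pos hx, if_pos hy, mul_one]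
        · rw [if_neg (fun h => hy ((hxy.mp h).mp hx)), if_pos hx, if_neg hy, one_mul]
        · rw [if_neg (fun h => hx ((hxy.mp h).mpr hy)), if_neg hx, if_pos hy, mul_one]
        · rw [if_pos (hxy.mpr (iff_of_false hx hy)), if_neg hx, if_neg hy, neg_mul_neg, mul_one] }
  refine hi ⟨η, fun h => hs ?_, fun x => ?_⟩
  · have e := DFunLike.congr_fun h s
    by_contra hps
    change (if g s (vecMulVec v₁ w₁) ∈ k ∙ vecMulVec v₁ w₁ then (1 : kˣ) else -1) = 1 at e
    rw [if_neg hps] at e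
    exact hneg (by rw [e, Units.val_one])
  · by_cases hx : g x (vecMulVec v₁ w₁) ∈ k ∙ vecMulVec v₁ w₁
    · change _ = ((if g x (vecMulVec v₁ w₁) ∈ k ∙ vecMulVec v₁ w₁ then (1 : kˣ) else -1 : kˣ) : k) * _
      rw [if_pos hx, Units.val_one, one_mul]
    · rw [htr x hx, mul_zero]

end Plane

/-! ## The criterion -/

/-- **Irreducibility of `V ⊗ V'` (classification-free).**  Let `k` be algebraically closed with
`2 ≠ 0`, and `V, V' : Λ → GL₂(k)` without common eigenvector, `V` non-dihedral in trace form
(no character `η ≠ 1` with `tr V = η · tr V`) and `V'` not conjugate to a twist `χ ⊗ V`.  Then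
the only subspaces of `M₂(k)` stable under `X ↦ V(λ) X V'(λ)ᵀ` (the tensor product `V ⊗ V'`)
are `0` and `M₂(k)`: by dimension, a proper stable subspace is a line (`not_stable_line`), a
hyperplane (whose `B`-orthogonal is a stable line, `B` the determinant pairing, for which pairs
act by similitudes), or a plane `W`, for which `W ∩ W^⊥` is a stable line, or `W` (totally
isotropic, `not_stable_isotropic_plane`), or `0` (`not_stable_nondegenerate_plane`).  This is the
representation-theoretic input of Calegari's tensor-induction argument. [cite: Calegari2010, §2 and §6 (the tensor representation and its residual image)] -/
theorem stub_residualIrreducibility_tensor : ∀ (k : Type) [Field k] [IsAlgClosed k], (2 : k) ≠ 0 → ∀ (Λ : Type) [Group Λ] (V V' : Λ →* GL (Fin 2) k), (∀ v : Fin 2 → k, v ≠ 0 → ∃ x, (V x).val.mulVec v ∉ k ∙ v) → (∀ v : Fin 2 → k, v ≠ 0 → ∃ x, (V' x).val.mulVec v ∉ k ∙ v) → (¬ ∃ η : Λ →* kˣ, η ≠ 1 ∧ ∀ x, (V x).val.trace = (η x : k) * (V x).val.trace) → (¬ ∃ (χ : Λ →* kˣ) (P : GL (Fin 2) k), ∀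 x, (V' x).val = (χ x : k) • (P * V x * P⁻¹).val) → ∀ W : Submodule k (Matrix (Fin 2) (Fin 2) k), (∀ x, ∀ X ∈ W, (V x).val * X * (V' x).val.transpose ∈ W) → W = ⊥ ∨ W = ⊤ := by
  intro k _ _ h2 Λ _ V V' hV hV' hi hii W hW
  by_contra hcon
  push Not at hcon
  obtain ⟨hbot, htop⟩ := hcon
  obtain ⟨B, hB⟩ := exists_pairing (k := k)
  -- stability of `W` under the inverse pairs, and of `W^⊥`
  have hinv : ∀ x, ∀ X ∈ W, (((V x)⁻¹ : GL (Fin 2) k) : Matrix (Fin 2) (Fin 2) k) * X *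
      ((((V' x)⁻¹ : GL (Fin 2) k) : Matrix (Fin 2) (Fin 2) k))ᵀ ∈ W := fun x X hX => by
    simpa only [map_inv] using hW x⁻¹ X hX
  have hperp : ∀ (U : Submodule k (Matrix (Fin 2) (Fin 2) k)),
      (∀ x, ∀ X ∈ U, ((V x : GL (Fin 2) k) : Matrix (Fin 2) (Fin 2) k) * X *
        ((V' x : GL (Fin 2) k) : Matrix (Fin 2) (Fin 2) k)ᵀ ∈ U) →
      ∀ x, ∀ X ∈ B.orthogonal U, ((V x : GL (Fin 2) k) : Matrix (Fin 2) (Fin 2) k) * X *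
        ((V' x : GL (Fin 2) k) : Matrix (Fin 2) (Fin 2) k)ᵀ ∈ B.orthogonal U := by
    intro U hU x X hX
    refine conj_mem_orthogonal (pairing_isRefl hB) (pairing_conj hB) (fun Y hY => ?_) hX
    simpa only [map_inv] using hU x⁻¹ Y hY
  -- the dimension of `W`
  have hW0 : finrank k W ≠ 0 := fun h => hbot (Submodule.finrank_eq_zero.mp h)
  have hW4 : finrank k W ≠ 4 := fun h => htop
    (Submodule.eq_top_of_finrank_eq (h.trans finrank_matrix_two.symm))
  have hWle : finrank k W ≤ 4 := by
    have := Submodule.finrank_le W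
    rwa [finrank_matrix_two] at this
  have hcase : finrank k W = 1 ∨ finrank k W = 2 ∨ finrank k W = 3 := by omega
  rcases hcase with hW1 | hW2 | hW3
  · exact not_stable_of_finrank_eq_one V V' hV hii hW hW1
  · -- a plane: look at `W ∩ W^⊥`
    set U := W ⊓ B.orthogonal W with hU
    have hUstab : ∀ x, ∀ X ∈ U, ((V x : GL (Fin 2) k) : Matrix (Fin 2) (Fin 2) k) * X *
        ((V' x : GL (Fin 2) k) : Matrix (Fin 2) (Fin 2) k)ᵀ ∈ U := fun x X hX =>
      ⟨hW x X hX.1, hperp W hW x X hX.2⟩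
    have hUle : finrank k U ≤ 2 := by
      have : finrank k U ≤ finrank k W := Submodule.finrank_mono inf_le_left
      rwa [hW2] at this
    have hUcase : finrank k U = 0 ∨ finrank k U = 1 ∨ finrank k U = 2 := by omega
    rcases hUcase with hU0 | hU1 | hU2
    · exact not_stable_nondegenerate_plane V V' hV hi hii h2 hB hW hW2
        (Submodule.finrank_eq_zero.mp hU0)
    · exact not_stable_of_finrank_eq_one V V' hV hii hUstab hU1
    · have hUW : U = W := Submodule.eq_of_le_of_finrank_eq inf_le_left (hU2.trans hW2.symm)
      refine not_stable_isotropic_plane V V' hV hV' h2 hB hW hW2 fun X hX Y hY => ?_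
      have hY' : Y ∈ B.orthogonal W := by
        have : Y ∈ U := hUW ▸ hY
        exact this.2
      rw [LinearMap.BilinForm.mem_orthogonal_iff] at hY'
      exact hY' X hX
  · -- a hyperplane: its orthogonal is a stable line
    have h1 : finrank k (B.orthogonal W) = 1 := by
      rw [finrank_orthogonal_of_nondegenerate (pairing_nondegenerate hB), hW3]
    exact not_stable_of_finrank_eq_one V V' hV hii (hperp W hW) h1

end Summit.Langlands.Langlands.Theorems.TensorSquareParallel

end
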